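/-
Copyright (c) 2026. All rights reserved.
Released under Apache 2.0 license as described in the file LICENSE.
-/
import Literature.MathematicalPhysics.QuantumLattice.HubbardStaggeredMomentCeiling
import Summits.HubbardSuperconductivity.HubbardLadder.HubbardDoubleOccRows
import HarnessLib

/-!
# R2 rows: certified brackets on the local moment and a certified CEILING on the staggered
# magnetisation of the half-filled `4 × 4` Hubbard torus (`U = 2, 4, 6, 8`)

HONEST FRAMING: ladder R1–R4 with certified numbers; no claim on H/H₀.
Cell `pub-hubbard`, seat r2 (observable brackets), R2-TABLE rows B1/B2 (observables `m_loc`, `m_s²`).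

Objects (OBSERVABLES.md §3, conventions of LeBlanc et al. PRX 5 (2015) 041041 §II and
Qin–Shi–Zhang PRB 94 (2016) 085103 §IV): for a normalised ground state `ψ` of `H(t = 1, U)` on the
`4 × 4` torus in the half-filled sector `N = 16`,
* the LOCAL MOMENT `m_loc = (1/16) Σ_x ⟨ψ, (n_{x↑} - n_{x↓})² ψ⟩ = (1/16) Σ_x ⟨ψ, m_x ψ⟩ = 1 - 2d`
  (`m_x = n_{x↑} + n_{x↓} - 2n_{x↑}n_{x↓}`, `d` the double-occupancy density) — the quantity
  `⟨σ_z²⟩` of Hirsch, PRB 31 (1985) 4403, Table II;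
* the SQUARED STAGGERED MAGNETISATION `m_s² = (1/16²) Σ_{x,y} ε_x ε_y ⟨ψ, 𝐒_x·𝐒_y ψ⟩`,
  `ε_x = (-1)^{x₁+x₂}`, `𝐒_x` the electron spin at `x` (`= S(π,π)/16` in the structure-factor
  normalisation `S(q) = (1/N) Σ e^{iq(x-y)} ⟨𝐒_x·𝐒_y⟩`).

## Method (kernel ∘ certificate; no new numerics, 0 core-h)

KERNEL (tree, `Literature/…/HubbardSpinMomentBounds`, `…/HubbardStaggeredMomentCeiling`, CAR algebra
only): `𝐒_x·𝐒_x = ¾ m_x`, the exchange bound `𝐒_x·𝐒_y ≤ ¼ m_x m_y` (`x ≠ y`) and `m_x m_y ≤ m_x` give the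
operator inequality ("moment-depletion ceiling") `Σ_{x,y} ε_xε_y 𝐒_x·𝐒_y ≤ ((k+2)/2) Σ_x m_x` for any
bipartition with parts of size `≤ k`, and `Σ_x m_x = N̂ - 2D̂`. On the `4 × 4` torus (`k = 8`,
`N = 16`): `m_s² ≤ (5/16)(1 - 2d)` and `m_loc = 1 - 2d` in every `16`-particle unit vector.
CERTIFICATES: exactly the hypotheses of the landed double-occupancy rows
`HubbardDoubleOccRows.doubleOcc_four_U{2,4,6,8}_mem_Icc_of_groundEnergy_le / _of_bounds` (ONE ED-tight
exact-rational Rayleigh upper bound `E_16(U) ≤ R` of the lineage, pub-mbboot E2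
`upper_torus4x4_t1_U{2,4,6,8}_N16_s8_8`, plus — for the sharper rows — the lineage's certified SDP lower
bounds `cert_hub_torus4x4_U{2,4,6,8,12}_N16_b4eom_pol` at the neighbouring couplings), through which
`d` is bracketed (INHERITED certificates cited by name, not re-verified here).

Rows (decimals rounded OUTWARD from the exact rationals; `m_s²` rows are CEILINGS only — a
solver-free floor on `m_s²` for lattice fermions is not available (no reflection positivity), the
floor is r3/eng business behind the numerics gate):
| `U` | `m_loc = 1 - 2d` (∘ upper + SDP lower certs) | `m_s² ≤` (∘ 1 upper cert) | `m_s² ≤` (∘ upper + SDP lower certs) | comparators for `m_loc` |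
|-----|-----------------------------------------------|---------------------------|---------------------------------------|-------------------------|
| 2   | `[0.6260, 0.7514]`                            | `0.2689`                  | `0.2349`                              | TL `1 - 2d = 0.6154` (OUTSIDE, below: the certified open-shell effect of the `d` row) |
| 4   | `[0.7156, 0.8434]`                            | `0.2891`                  | `0.2636`                              | TL `0.7476`: INSIDE |
| 6   | `[0.7820, 0.9056]`                            | `0.2990`                  | `0.2830`                              | TL `0.8380`: INSIDE |
| 8   | `[0.8346, 0.9362]`                            | `0.3040`                  | `0.2926`                              | TL `0.8920`: INSIDE; DQMC `⟨σ_z²⟩ = 0.899(3)` (`4 × 4`, `β = 3`, Hirsch 1985 Table II): INSIDE |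
(TL = thermodynamic-limit AFQMC `d = 0.1923(3), 0.1262(2), 0.0810, 0.0540(1)` of Qin–Shi–Zhang 2016
§IV.A, uncertified comparators.) For orientation only (different objects): the Heisenberg (`U → ∞`)
`4 × 4` value is `m_s² = 0.2765` (certified bracket `[0.1637, 0.3125]`, `NeelOrderParamCeiling`); at
`d = 0` the ceiling is the Casimir value `5/16 = 0.3125`; no certified or page-confirmed ground-state
`m_s²` of the `4 × 4` Hubbard torus is claimed here as comparator.

## References
* J. E. Hirsch, Phys. Rev. B 31 (1985) 4403, Table II (local moment and nearest-neighbour spin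
  correlation of the `4 × 4` lattice at `U = 8`, `β = 3`). [cite: HirschPRB1985, Table II]
* H. Tasaki, *Physics and Mathematics of Quantum Many-Body Systems* (2020), App. A.3.
  [cite: Tasaki2020, App. A.3]
* T. Koma, H. Tasaki, J. Stat. Phys. 76 (1994) 745, §1 (the concavity sandwich behind the `d` rows).
  [cite: KomaTasaki1994, §1]
* M. Qin, H. Shi, S. Zhang, Phys. Rev. B 94 (2016) 085103, §IV.A (TL double occupancy; comparator
  only). [cite: QinShiZhang2016, §IV.A]
-/

noncomputable section

namespace Summit.HubbardSuperconductivity.HubbardLadder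

open Literature.MathematicalPhysics.QuantumLattice Literature.Probability.LatticeModels
open FermionSpinMoment Matrix

/-! ### The bipartition of the `4 × 4` fermion torus and the two observables -/

/-- The even sublattice `A = {x : x₁ + x₂ even}` of the `4 × 4` torus (fermion site type
`FermionTorus 2 4 = Lex (Fin 2 → Fin 4)`). [cite: LiebPRL1989, Thm. 2] -/
def evenSitesFour : Finset (FermionTorus 2 4) :=
  Finset.univ.filter fun x => Even ((ofLex x 0).val + (ofLex x 1).val)

/-- `|A| = 8`. [cite: LiebPRL1989, Thm. 2] -/
theorem card_evenSitesFour : evenSitesFour.card = 8 := by decide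

/-- `|Λ| = 16`. [cite: LiebPRL1989, Thm. 2] -/
theorem card_fermionTorusFour : Fintype.card (FermionTorus 2 4) = 16 := rfl

/-- The staggered sign of the kernel's `stagSign A` is `ε_x = (-1)^{x₁+x₂}`. [cite: LiebPRL1989, Thm. 2] -/
theorem stagSign_evenSitesFour (x : FermionTorus 2 4) :
    stagSign evenSitesFour x = (-1 : ℂ) ^ ((ofLex x 0).val + (ofLex x 1).val) := by
  by_cases h : Even ((ofLex x 0).val + (ofLex x 1).val)
  · rw [h.neg_one_pow]
    exact stagSign_of_mem (by simpa [evenSitesFour] using h)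
  · rw [(Nat.not_even_iff_odd.1 h).neg_one_pow]
    exact stagSign_of_mem_compl (by simpa [evenSitesFour, Finset.mem_compl] using h)

/-- **The staggered spin structure operator** of the `4 × 4` Hubbard torus,
`𝓢 = Σ_{x,y} (-1)^{x₁+x₂} (-1)^{y₁+y₂} 𝐒_x·𝐒_y` (`= 16² · m_s²` in a unit vector; `= 16 · S(π,π)`).
[cite: HirschPRB1985, eq. (4.7)] -/
def stagStructureFour : Matrix (Finset (Orb (FermionTorus 2 4))) (Finset (Orb (FermionTorus 2 4))) ℂ :=
  stagSpinStructure evenSitesFour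

/-- `𝓢 = Σ_{x,y} (-1)^{x₁+x₂+y₁+y₂} 𝐒_x·𝐒_y` explicitly. [cite: HirschPRB1985, eq. (4.7)] -/
theorem stagStructureFour_eq :
    stagStructureFour = ∑ x : FermionTorus 2 4, ∑ y : FermionTorus 2 4,
      ((-1 : ℂ) ^ ((ofLex x 0).val + (ofLex x 1).val) * (-1 : ℂ) ^ ((ofLex y 0).val + (ofLex y 1).val)) •
        fermionSpinDot x y := by
  simp only [stagStructureFour, stagSpinStructure, stagSign_evenSitesFour]

/-- **The local moment operator** `M = Σ_x m_x = Σ_x (n_{x↑} - n_{x↓})²` of the `4 × 4` torus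
(`m_x = (n_{x↑} - n_{x↓})²` is `FermionSpinMoment.localMoment_eq_sq`). [cite: HirschPRB1985, Table II] -/
def localMomentFour : Matrix (Finset (Orb (FermionTorus 2 4))) (Finset (Orb (FermionTorus 2 4))) ℂ :=
  ∑ x : FermionTorus 2 4, localMoment x

/-! ### The two kernel statements on the `4 × 4` torus -/

/-- **Local moment = `1 - 2d`**: in an `N`-particle unit vector, `⟨M⟩ = N - 2⟨D̂⟩`.
[cite: HirschPRB1985, Table II] -/
theorem re_expect_localMomentFour {N : ℕ} {ψ : Fock (Orb (FermionTorus 2 4))} (hN : IsNParticle N ψ)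
    (hψ1 : star ψ ⬝ᵥ ψ = 1) :
    (expect localMomentFour ψ).re =
      N - 2 * (expect (∑ x : FermionTorus 2 4, numberOp x 0 * numberOp x 1) ψ).re := by
  unfold expect localMomentFour
  rw [sum_localMoment_eq, sub_mulVec, smul_mulVec, totalNumber_mulVec_of_isNParticle hN, dotProduct_sub,
    dotProduct_smul, dotProduct_smul, hψ1, Complex.sub_re, smul_eq_mul, mul_one, Complex.natCast_re, smul_eq_mul,
    Complex.mul_re, Complex.re_ofNat, Complex.im_ofNat, zero_mul, sub_zero]

/-- **Moment-depletion ceiling on the `4 × 4` torus**: in an `N`-particle unit vector,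
`⟨𝓢⟩ ≤ 5 (N - 2⟨D̂⟩)`. [cite: Tasaki2020, App. A.3] -/
theorem re_expect_stagStructureFour_le {N : ℕ} {ψ : Fock (Orb (FermionTorus 2 4))} (hN : IsNParticle N ψ)
    (hψ1 : star ψ ⬝ᵥ ψ = 1) :
    (expect stagStructureFour ψ).re ≤
      5 * (N - 2 * (expect (∑ x : FermionTorus 2 4, numberOp x 0 * numberOp x 1) ψ).re) := by
  have hA : evenSitesFour.card ≤ 8 := le_of_eq card_evenSitesFour
  have h := re_expect_stagSpinStructure_le evenSitesFour (k := 8) hA ?_ hN hψ1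
  · rw [show (((8 : ℕ) : ℝ) + 2) / 2 = 5 by norm_num] at h
    exact h
  · -- `|Aᶜ| = 8`; `convert` bridges the two (propositionally equal) `DecidableEq` instances on
    -- `Lex (Fin 2 → Fin 4)` (the kernel's `LinearOrder`-derived one and the computable one).
    have h8 : evenSitesFourᶜ.card ≤ 8 := by decide
    convert h8

/-! ### Rows: the local moment `m_loc = ⟨M⟩/16` (two-sided) -/

/-- **R2 row B.m at `U = 2`.** `m_loc ∈ [0.6260, 0.7514]` (∘ the certificates of
`doubleOcc_four_U2_mem_Icc_of_bounds`). [cite: HirschPRB1985, Table II] -/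
theorem localMoment_four_U2_mem_Icc {ψ : Fock (Orb (FermionTorus 2 4))}
    (hψ : IsGroundState (hamiltonian (fermionTorusGraph 2 4) 1 2) 16 ψ) (hψ1 : star ψ ⬝ᵥ ψ = 1)
    (hR : groundEnergyAt (fermionTorusGraph 2 4) 1 2 16 ≤ -18.0175711)
    (hL₂ : (-14.0382299 : ℝ) ≤ groundEnergyAt (fermionTorusGraph 2 4) 1 4 16) :
    (expect localMomentFour ψ).re / 16 ∈ Set.Icc (0.6260 : ℝ) 0.7514 := by
  obtain ⟨h1, h2⟩ := doubleOcc_four_U2_mem_Icc_of_bounds hψ hψ1 hR hL₂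
  rw [re_expect_localMomentFour hψ.1 hψ1]
  constructor <;> push_cast <;> linarith

/-- **R2 row B1.m at `U = 4`.** `m_loc ∈ [0.7156, 0.8434]` (∘ the certificates of
`doubleOcc_four_U4_mem_Icc_of_bounds`; TL AFQMC `1 - 2d = 0.7476` inside).
[cite: HirschPRB1985, Table II] -/
theorem localMoment_four_U4_mem_Icc {ψ : Fock (Orb (FermionTorus 2 4))}
    (hψ : IsGroundState (hamiltonian (fermionTorusGraph 2 4) 1 4) 16 ψ) (hψ1 : star ψ ⬝ᵥ ψ = 1)
    (hL₁ : (-18.1702781 : ℝ) ≤ groundEnergyAt (fermionTorusGraph 2 4) 1 2 16)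
    (hR : groundEnergyAt (fermionTorusGraph 2 4) 1 4 16 ≤ -13.6218519)
    (hL₂ : (-11.1131766 : ℝ) ≤ groundEnergyAt (fermionTorusGraph 2 4) 1 6 16) :
    (expect localMomentFour ψ).re / 16 ∈ Set.Icc (0.7156 : ℝ) 0.8434 := by
  obtain ⟨h1, h2⟩ := doubleOcc_four_U4_mem_Icc_of_bounds hψ hψ1 hL₁ hR hL₂
  rw [re_expect_localMomentFour hψ.1 hψ1]
  constructor <;> push_cast <;> linarith

/-- **R2 row B.m at `U = 6`.** `m_loc ∈ [0.7820, 0.9056]` (∘ the certificates of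
`doubleOcc_four_U6_mem_Icc_of_bounds`). [cite: HirschPRB1985, Table II] -/
theorem localMoment_four_U6_mem_Icc {ψ : Fock (Orb (FermionTorus 2 4))}
    (hψ : IsGroundState (hamiltonian (fermionTorusGraph 2 4) 1 6) 16 ψ) (hψ1 : star ψ ⬝ᵥ ψ = 1)
    (hL₁ : (-14.0382299 : ℝ) ≤ groundEnergyAt (fermionTorusGraph 2 4) 1 4 16)
    (hR : groundEnergyAt (fermionTorusGraph 2 4) 1 6 16 ≤ -10.5521941)
    (hL₂ : (-9.0396662 : ℝ) ≤ groundEnergyAt (fermionTorusGraph 2 4) 1 8 16) :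
    (expect localMomentFour ψ).re / 16 ∈ Set.Icc (0.7820 : ℝ) 0.9056 := by
  obtain ⟨h1, h2⟩ := doubleOcc_four_U6_mem_Icc_of_bounds hψ hψ1 hL₁ hR hL₂
  rw [re_expect_localMomentFour hψ.1 hψ1]
  constructor <;> push_cast <;> linarith

/-- **R2 row B2.m at `U = 8`.** `m_loc ∈ [0.8346, 0.9362]` (∘ the certificates of
`doubleOcc_four_U8_mem_Icc_of_bounds`). Comparator: DQMC `⟨σ_z²⟩ = 0.899(3)` on the `4 × 4` lattice at
`β = 3` (Hirsch 1985 Table II) — INSIDE the certified ground-state bracket. [cite: HirschPRB1985, Table II] -/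
theorem localMoment_four_U8_mem_Icc {ψ : Fock (Orb (FermionTorus 2 4))}
    (hψ : IsGroundState (hamiltonian (fermionTorusGraph 2 4) 1 8) 16 ψ) (hψ1 : star ψ ⬝ᵥ ψ = 1)
    (hL₁ : (-11.1131766 : ℝ) ≤ groundEnergyAt (fermionTorusGraph 2 4) 1 6 16)
    (hR : groundEnergyAt (fermionTorusGraph 2 4) 1 8 16 ≤ -8.4688588)
    (hL₂ : (-6.4248475 : ℝ) ≤ groundEnergyAt (fermionTorusGraph 2 4) 1 12 16) :
    (expect localMomentFour ψ).re / 16 ∈ Set.Icc (0.8346 : ℝ) 0.9362 := by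
  obtain ⟨h1, h2⟩ := doubleOcc_four_U8_mem_Icc_of_bounds hψ hψ1 hL₁ hR hL₂
  rw [re_expect_localMomentFour hψ.1 hψ1]
  constructor <;> push_cast <;> linarith

/-! ### Rows: the ceiling on `m_s² = ⟨𝓢⟩/256` -/

/-- **R2 row B.S at `U = 2` (kernel ∘ 1 certificate).** `m_s² ≤ 0.2689` if `E_16(2) ≤ -18.0175711`.
[cite: Tasaki2020, App. A.3] -/
theorem stagMagSq_four_U2_le_of_groundEnergy_le {ψ : Fock (Orb (FermionTorus 2 4))}
    (hψ : IsGroundState (hamiltonian (fermionTorusGraph 2 4) 1 2) 16 ψ) (hψ1 : star ψ ⬝ᵥ ψ = 1)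
    (hR : groundEnergyAt (fermionTorusGraph 2 4) 1 2 16 ≤ -18.0175711) :
    (expect stagStructureFour ψ).re / 256 ≤ 0.2689 := by
  have hd := (doubleOcc_four_U2_mem_Icc_of_groundEnergy_le hψ hψ1 hR).1
  have h := re_expect_stagStructureFour_le hψ.1 hψ1
  push_cast at h
  linarith

/-- **R2 row B.S′ at `U = 2` (kernel ∘ 2 certificates).** `m_s² ≤ 0.2349`. [cite: Tasaki2020, App. A.3] -/
theorem stagMagSq_four_U2_le_of_bounds {ψ : Fock (Orb (FermionTorus 2 4))}
    (hψ : IsGroundState (hamiltonian (fermionTorusGraph 2 4) 1 2) 16 ψ) (hψ1 : star ψ ⬝ᵥ ψ = 1)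
    (hR : groundEnergyAt (fermionTorusGraph 2 4) 1 2 16 ≤ -18.0175711)
    (hL₂ : (-14.0382299 : ℝ) ≤ groundEnergyAt (fermionTorusGraph 2 4) 1 4 16) :
    (expect stagStructureFour ψ).re / 256 ≤ 0.2349 := by
  have hd := (doubleOcc_four_U2_mem_Icc_of_bounds hψ hψ1 hR hL₂).1
  have h := re_expect_stagStructureFour_le hψ.1 hψ1
  push_cast at h
  linarith

/-- **R2 row B1.S at `U = 4` (kernel ∘ 1 certificate).** `m_s² ≤ 0.2891` if `E_16(4) ≤ -13.6218519`.
[cite: Tasaki2020, App. A.3] -/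
theorem stagMagSq_four_U4_le_of_groundEnergy_le {ψ : Fock (Orb (FermionTorus 2 4))}
    (hψ : IsGroundState (hamiltonian (fermionTorusGraph 2 4) 1 4) 16 ψ) (hψ1 : star ψ ⬝ᵥ ψ = 1)
    (hR : groundEnergyAt (fermionTorusGraph 2 4) 1 4 16 ≤ -13.6218519) :
    (expect stagStructureFour ψ).re / 256 ≤ 0.2891 := by
  have hd := (doubleOcc_four_U4_mem_Icc_of_groundEnergy_le hψ hψ1 hR).1
  have h := re_expect_stagStructureFour_le hψ.1 hψ1
  push_cast at h
  linarith

/-- **R2 row B1.S′ at `U = 4` (kernel ∘ 3 certificates).** `m_s² ≤ 0.2636`. [cite: Tasaki2020, App. A.3] -/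
theorem stagMagSq_four_U4_le_of_bounds {ψ : Fock (Orb (FermionTorus 2 4))}
    (hψ : IsGroundState (hamiltonian (fermionTorusGraph 2 4) 1 4) 16 ψ) (hψ1 : star ψ ⬝ᵥ ψ = 1)
    (hL₁ : (-18.1702781 : ℝ) ≤ groundEnergyAt (fermionTorusGraph 2 4) 1 2 16)
    (hR : groundEnergyAt (fermionTorusGraph 2 4) 1 4 16 ≤ -13.6218519)
    (hL₂ : (-11.1131766 : ℝ) ≤ groundEnergyAt (fermionTorusGraph 2 4) 1 6 16) :
    (expect stagStructureFour ψ).re / 256 ≤ 0.2636 := by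
  have hd := (doubleOcc_four_U4_mem_Icc_of_bounds hψ hψ1 hL₁ hR hL₂).1
  have h := re_expect_stagStructureFour_le hψ.1 hψ1
  push_cast at h
  linarith

/-- **R2 row B.S at `U = 6` (kernel ∘ 1 certificate).** `m_s² ≤ 0.2990` if `E_16(6) ≤ -10.5521941`.
[cite: Tasaki2020, App. A.3] -/
theorem stagMagSq_four_U6_le_of_groundEnergy_le {ψ : Fock (Orb (FermionTorus 2 4))}
    (hψ : IsGroundState (hamiltonian (fermionTorusGraph 2 4) 1 6) 16 ψ) (hψ1 : star ψ ⬝ᵥ ψ = 1)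
    (hR : groundEnergyAt (fermionTorusGraph 2 4) 1 6 16 ≤ -10.5521941) :
    (expect stagStructureFour ψ).re / 256 ≤ 0.2990 := by
  have hd := (doubleOcc_four_U6_mem_Icc_of_groundEnergy_le hψ hψ1 hR).1
  have h := re_expect_stagStructureFour_le hψ.1 hψ1
  push_cast at h
  linarith

/-- **R2 row B.S′ at `U = 6` (kernel ∘ 3 certificates).** `m_s² ≤ 0.2830`. [cite: Tasaki2020, App. A.3] -/
theorem stagMagSq_four_U6_le_of_bounds {ψ : Fock (Orb (FermionTorus 2 4))}
    (hψ : IsGroundState (hamiltonian (fermionTorusGraph 2 4) 1 6) 16 ψ) (hψ1 : star ψ ⬝ᵥ ψ = 1)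
    (hL₁ : (-14.0382299 : ℝ) ≤ groundEnergyAt (fermionTorusGraph 2 4) 1 4 16)
    (hR : groundEnergyAt (fermionTorusGraph 2 4) 1 6 16 ≤ -10.5521941)
    (hL₂ : (-9.0396662 : ℝ) ≤ groundEnergyAt (fermionTorusGraph 2 4) 1 8 16) :
    (expect stagStructureFour ψ).re / 256 ≤ 0.2830 := by
  have hd := (doubleOcc_four_U6_mem_Icc_of_bounds hψ hψ1 hL₁ hR hL₂).1
  have h := re_expect_stagStructureFour_le hψ.1 hψ1
  push_cast at h
  linarith

/-- **R2 row B2.S at `U = 8` (kernel ∘ 1 certificate).** `m_s² ≤ 0.3040` if `E_16(8) ≤ -8.4688588`.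
[cite: Tasaki2020, App. A.3] -/
theorem stagMagSq_four_U8_le_of_groundEnergy_le {ψ : Fock (Orb (FermionTorus 2 4))}
    (hψ : IsGroundState (hamiltonian (fermionTorusGraph 2 4) 1 8) 16 ψ) (hψ1 : star ψ ⬝ᵥ ψ = 1)
    (hR : groundEnergyAt (fermionTorusGraph 2 4) 1 8 16 ≤ -8.4688588) :
    (expect stagStructureFour ψ).re / 256 ≤ 0.3040 := by
  have hd := (doubleOcc_four_U8_mem_Icc_of_groundEnergy_le hψ hψ1 hR).1
  have h := re_expect_stagStructureFour_le hψ.1 hψ1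
  push_cast at h
  linarith

/-- **R2 row B2.S′ at `U = 8` (kernel ∘ 3 certificates).** `m_s² ≤ 0.2926`. [cite: Tasaki2020, App. A.3] -/
theorem stagMagSq_four_U8_le_of_bounds {ψ : Fock (Orb (FermionTorus 2 4))}
    (hψ : IsGroundState (hamiltonian (fermionTorusGraph 2 4) 1 8) 16 ψ) (hψ1 : star ψ ⬝ᵥ ψ = 1)
    (hL₁ : (-11.1131766 : ℝ) ≤ groundEnergyAt (fermionTorusGraph 2 4) 1 6 16)
    (hR : groundEnergyAt (fermionTorusGraph 2 4) 1 8 16 ≤ -8.4688588)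
    (hL₂ : (-6.4248475 : ℝ) ≤ groundEnergyAt (fermionTorusGraph 2 4) 1 12 16) :
    (expect stagStructureFour ψ).re / 256 ≤ 0.2926 := by
  have hd := (doubleOcc_four_U8_mem_Icc_of_bounds hψ hψ1 hL₁ hR hL₂).1
  have h := re_expect_stagStructureFour_le hψ.1 hψ1
  push_cast at h
  linarith

end Summit.HubbardSuperconductivity.HubbardLadder
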